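import Mathlib
import Literature.NumberTheory.LFunctions.Zhang2022.Section17U021ChiR1Assembly
import Literature.NumberTheory.LFunctions.Zhang2022.Section17U021ChiR1M1Sum
import Literature.NumberTheory.LFunctions.Zhang2022.Section17U021ChiR1SmallArgsEventually
import Literature.NumberTheory.LFunctions.Zhang2022.Section17FrakACurrencyCounts
import Literature.NumberTheory.LFunctions.Zhang2022.Section15Eq1523Edge
import Literature.NumberTheory.LFunctions.Zhang2022.Section10Theta1Evals
import HarnessLib

/-!
# Zhang (2022) §17.u021 (χ-reading), remainder `R₁`: the SMALL-ARGUMENT piece `hS` of the assembly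
# skeleton, DISCHARGED (cut v3: M1 + M2s + the two `𝔞`-currency outer counts)

Topic `Literature/NumberTheory/LFunctions/Zhang2022` (Landau–Siegel audit tree; verdict-neutral).
Y. Zhang, *Discrete mean estimates and the Landau–Siegel zero*, arXiv:2211.02515v1 (2022)
[Zhang2022LandauSiegel] — **an unrefereed manuscript under adjudication; nothing here asserts or denies
its Theorems 1–2, and no claim about Landau–Siegel zeros is made.** Lane ZHANG-L, WP16, leaf h17_9,
sub-leaf `R₁` of `Typed.Section17.Step17_u021Chi` («R1Rel c′»); companion of
`Section17U021ChiR1Assembly` (`Phi3Eval.step17_u021Chi_R1Rel_of_split : hS → hLc → hLp → R1Rel c′`).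
§17 p. 98, tex L4825 ("we can drop the terms with `m₂ > 1` … with an acceptable error").

This file PROVES the hypothesis `hS` (SMALL arguments `q₂m₂ ≤ D⁴`) of the skeleton outright, from
four tree theorems (ZHANG-L cut v3 = ruling W16-S5g, organisation «`m₁` inside»):

* M1 `Typed.Section17.m1Sum_le` — `Σ'_{m₁}‖b(q₁m₁)‖‖κ̄₂(m₁m₂)‖/m₁ ≤ C·τ(q₁)·‖κ̄₂(m₂)‖·(m₂/φ(m₂))²`;
* M2s `Typed.Section17.smallArgs_sum_eventually` —
  `Σ_{2≤m₂≤N,(m₂,l₁)=1}‖ν₁*(l₂m₂)‖‖κ̄₂(m₂)‖(m₂/φm₂)²/m₂ ≤ 8α𝓛·(e³²‖(μχ∗1)(l₂)‖(1+4𝓛)² +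
  63e¹²⁸·α𝓛·τ₄(l₂)(1+4𝓛)⁴)` for `l₂N ≤ D⁴`;
* A1a/A1b `Typed.Section17.sum_nu_tau_moebiusChi_div_le_frakA` / `sum_nu_tau_tau4_div_le_frakA_cube` —
  the outer counts `≤ C(𝔞+1)(D/φD)³`, `≤ C(𝔞+1)³(D/φD)⁶` under (A);

plus `D/φ(D) ≤ 2 log 𝓛` (`Ded1524.self_div_totient_le_two_mul_loglog`, Landau), `𝔞 ≤ 16e⁹𝓛⁴`
(`Skeleton.frakA_le_ell_pow_four'`) and `α𝓛⁹ = π`. Sizes: the `‖(μχ∗1)‖`-term is `≪ α𝓛⁵(𝔞+1)`, the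
`τ₄`-term is `≪ α²𝓛⁹(𝔞+1)³ ≤ α²𝓛¹⁷E²(𝔞+1) = π²E²(𝔞+1)/𝓛` — each `≤ K(𝔞+1)/𝓛`.

PROVED (theorems only): `R1_small_size_one`, `R1_small_size_two` (real bookkeeping),
`R1_small_inner` (the inner double series at one `(q₁,q₂)` is a finite sum, `m₂`-range `m₂ ≤ ⌊D⁴/q₂⌋`,
Fubini, M1 termwise, M2s), `R1_small_holds (c′) : «hS»` VERBATIM as the hypothesis of
`step17_u021Chi_R1Rel_of_split`. WHAT THIS IS NOT: the large-argument pieces `hLc`, `hLp`.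

## References

* Y. Zhang, arXiv:2211.02515v1 (2022), §17 p. 98 (u020–u021), tex L4821–L4827.
  [cite: Zhang2022LandauSiegel, §17 u021 p.98]
-/

noncomputable section

open Complex Real Finset
open Literature.NumberTheory.LFunctions.Zhang2022.Skeleton
open Literature.NumberTheory.LFunctions.Zhang2022.Typed.Section17
open Literature.NumberTheory.LFunctions.Zhang2022.MeanSquareMajorant

namespace Literature.NumberTheory.LFunctions.Zhang2022.Phi3Eval

/-! ## §1. Two closing size computations -/

/-- Size bookkeeping for the `‖(μχ∗1)‖`-weighted term: with `αL⁹ = π`, `Lg ≤ 5L` and the outer count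
`S ≤ Ca'(𝔞+1)L²`, `c·(αL)·Lg²·S ≤ 25c·Ca'·π·(𝔞+1)/L` (`αL⁶ ≤ αL⁹ = π`).
[cite: Zhang2022LandauSiegel, §17 u021 p.98] -/
theorem R1_small_size_one {L α Lg c S A Ca : ℝ} (hL : 1 ≤ L) (hα : α * L ^ 9 = π) (hα0 : 0 ≤ α)
    (hc : 0 ≤ c) (hLg0 : 0 ≤ Lg) (hLg : Lg ≤ 5 * L) (hA : 0 ≤ A) (hCa : 0 ≤ Ca) (hS0 : 0 ≤ S)
    (hS : S ≤ Ca * (A + 1) * L ^ 2) :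
    c * (α * L) * Lg ^ 2 * S ≤ 25 * c * Ca * π * (A + 1) / L := by
  have hL0 : 0 < L := by linarith
  have hLg2 : Lg ^ 2 ≤ 25 * L ^ 2 := by nlinarith [pow_le_pow_left₀ hLg0 hLg 2]
  have h3 : c * (α * L) * Lg ^ 2 * S ≤ c * (α * L) * (25 * L ^ 2) * (Ca * (A + 1) * L ^ 2) :=
    mul_le_mul (mul_le_mul_of_nonneg_left hLg2 (by positivity)) hS hS0 (by positivity)
  refine h3.trans ?_
  rw [le_div_iff₀ hL0]
  have e6 : α * L ^ 6 ≤ π := by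
    rw [← hα]; exact mul_le_mul_of_nonneg_left (pow_le_pow_right₀ hL (by norm_num)) hα0
  have hX : 0 ≤ 25 * c * Ca * (A + 1) := by positivity
  have eq : c * (α * L) * (25 * L ^ 2) * (Ca * (A + 1) * L ^ 2) * L =
      25 * c * Ca * (A + 1) * (α * L ^ 6) := by ring
  rw [eq]
  have := mul_le_mul_of_nonneg_left e6 hX
  linarith

/-- Size bookkeeping for the `τ₄`-weighted term: with `αL⁹ = π`, `Lg ≤ 5L`, `𝔞+1 ≤ E·L⁴` and the
outer count `S ≤ Cb'(𝔞+1)³L³`, `c·(αL)·(αL)·Lg⁴·S ≤ 625c·Cb'·E²·π²·(𝔞+1)/L`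
(`α²L⁹(𝔞+1)² ≤ α²L¹⁷E² = π²E²/L`). [cite: Zhang2022LandauSiegel, §17 u021 p.98] -/
theorem R1_small_size_two {L α Lg c S A E Cb : ℝ} (hL : 1 ≤ L) (hα : α * L ^ 9 = π) (hα0 : 0 ≤ α)
    (hc : 0 ≤ c) (hLg0 : 0 ≤ Lg) (hLg : Lg ≤ 5 * L) (hA : 0 ≤ A) (hE : A + 1 ≤ E * L ^ 4)
    (hCb : 0 ≤ Cb) (hS0 : 0 ≤ S) (hS : S ≤ Cb * (A + 1) ^ 3 * L ^ 3) :
    c * (α * L) * (α * L) * Lg ^ 4 * S ≤ 625 * c * Cb * E ^ 2 * π ^ 2 * (A + 1) / L := by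
  have hL0 : 0 < L := by linarith
  have hLg4 : Lg ^ 4 ≤ 625 * L ^ 4 := by nlinarith [pow_le_pow_left₀ hLg0 hLg 4]
  have h2 : c * (α * L) * (α * L) * Lg ^ 4 * S ≤
      c * (α * L) * (α * L) * (625 * L ^ 4) * (Cb * (A + 1) ^ 3 * L ^ 3) :=
    mul_le_mul (mul_le_mul_of_nonneg_left hLg4 (by positivity)) hS hS0 (by positivity)
  refine h2.trans ?_
  rw [le_div_iff₀ hL0]
  have hsq : (A + 1) ^ 2 ≤ E ^ 2 * L ^ 8 := by
    have := pow_le_pow_left₀ (by linarith) hE 2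
    nlinarith
  have e9 : α ^ 2 * L ^ 9 * (A + 1) ^ 2 * L ≤ π ^ 2 * E ^ 2 := by
    have : α ^ 2 * L ^ 9 * (A + 1) ^ 2 * L ≤ α ^ 2 * L ^ 9 * (E ^ 2 * L ^ 8) * L :=
      mul_le_mul_of_nonneg_right (mul_le_mul_of_nonneg_left hsq (by positivity)) hL0.le
    refine this.trans (le_of_eq ?_)
    have h18 : α ^ 2 * L ^ 18 = π ^ 2 := by rw [← hα]; ring
    linear_combination E ^ 2 * h18
  have hX : 0 ≤ 625 * c * Cb * (A + 1) := by positivity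
  have eq : c * (α * L) * (α * L) * (625 * L ^ 4) * (Cb * (A + 1) ^ 3 * L ^ 3) * L =
      625 * c * Cb * (A + 1) * (α ^ 2 * L ^ 9 * (A + 1) ^ 2 * L) := by ring
  rw [eq]
  have := mul_le_mul_of_nonneg_left e9 hX
  refine this.trans (le_of_eq ?_)
  ring

/-- `D/φ(D)`-powers against `𝓛`: if `0 ≤ u ≤ 2 log L` and `1 ≤ L` then `u³ ≤ 64L²` and `u⁶ ≤ 4096L³`
(`log L ≤ 2√L`). [cite: Zhang2022LandauSiegel, §17 u021 p.98] -/
theorem pow_le_of_le_two_mul_log {u L : ℝ} (hu0 : 0 ≤ u) (hu : u ≤ 2 * Real.log L) (hL : 1 ≤ L) :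
    u ^ 3 ≤ 64 * L ^ 2 ∧ u ^ 6 ≤ 4096 * L ^ 3 := by
  have hL0 : 0 < L := by linarith
  have hs0 : 0 < Real.sqrt L := Real.sqrt_pos.mpr hL0
  have hs2 : Real.sqrt L ^ 2 = L := Real.sq_sqrt hL0.le
  have hs1 : 1 ≤ Real.sqrt L := by rw [← Real.sqrt_one]; exact Real.sqrt_le_sqrt hL
  -- `log L = 2 log √L ≤ 2(√L - 1) ≤ 2√L`
  have hlog : Real.log L ≤ 2 * Real.sqrt L := by
    have h1 : Real.log (Real.sqrt L) ≤ Real.sqrt L - 1 := Real.log_le_sub_one_of_pos hs0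
    have h2 : Real.log (Real.sqrt L) = Real.log L / 2 := Real.log_sqrt hL0.le
    rw [h2] at h1
    linarith
  have hu4 : u ≤ 4 * Real.sqrt L := by linarith
  have hu3 : u ^ 3 ≤ (4 * Real.sqrt L) ^ 3 := pow_le_pow_left₀ hu0 hu4 3
  have hu6 : u ^ 6 ≤ (4 * Real.sqrt L) ^ 6 := pow_le_pow_left₀ hu0 hu4 6
  have hsL : Real.sqrt L ≤ L := by nlinarith
  constructor
  · calc u ^ 3 ≤ (4 * Real.sqrt L) ^ 3 := hu3
      _ = 64 * (Real.sqrt L ^ 2 * Real.sqrt L) := by ring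
      _ = 64 * (L * Real.sqrt L) := by rw [hs2]
      _ ≤ 64 * (L * L) := by gcongr
      _ = 64 * L ^ 2 := by ring
  · calc u ^ 6 ≤ (4 * Real.sqrt L) ^ 6 := hu6
      _ = 4096 * (Real.sqrt L ^ 2) ^ 3 := by ring
      _ = 4096 * L ^ 3 := by rw [hs2]

/-! ## §2. The inner double series at one `(q₁, q₂)` -/

/-- The inner double series of the small-argument piece at one `(q₁, q₂)` («`m₁` inside»): it is the
finite sum `Σ_{2≤m₂≤⌊D⁴/q₂⌋,(m₂,q₁)=1} (‖ν₁*(q₂m₂)‖/m₂)·Σ'_{m₁}‖b(q₁m₁)‖‖κ̄₂(m₁m₂)‖/m₁` (supports,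
Fubini), the `m₁`-series is bounded by M1 termwise, and the resulting `m₂`-sum by M2s (`B`): total
`≤ |C₁|·τ(q₁)·B`. [cite: Zhang2022LandauSiegel, §17 u021 p.98] -/
theorem R1_small_inner {D : ℕ} [NeZero D] (χ : DirichletCharacter ℂ D) (c' : ℝ)
    {C₁ B : ℝ} {q₁ q₂ Nb : ℕ} (hq2 : 1 ≤ q₂)
    (hbN : ∀ m : ℕ, Nb ≤ m → bcoef D (q₁ * m) = 0)
    (hM1 : ∀ m₂ : ℕ, 1 ≤ m₂ →
      (∑' m₁ : ℕ, ‖bcoef D (q₁ * m₁)‖ * ‖kappa2bar c' D (m₁ * m₂)‖ / (m₁ : ℝ)) ≤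
        C₁ * (q₁.divisors.card : ℝ) * ‖kappa2bar c' D m₂‖ * ((m₂ : ℝ) / m₂.totient) ^ 2)
    (hM2 : ∑ m₂ ∈ (Finset.Icc 2 (D ^ 4 / q₂)).filter (fun m₂ => Nat.Coprime m₂ q₁),
        ‖nuOneStar c' χ (q₂ * m₂)‖ * ‖kappa2bar c' D m₂‖ * ((m₂ : ℝ) / Nat.totient m₂) ^ 2 / m₂ ≤
      B) :
    (∑' m₁ : ℕ, ∑' m₂ : ℕ,
        if (2 ≤ m₂ ∧ Nat.Coprime m₂ q₁) ∧ (q₂ : ℝ) * m₂ ≤ (D : ℝ) ^ 4 then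
          ‖bcoef D (q₁ * m₁)‖ * ‖nuOneStar c' χ (q₂ * m₂)‖ * ‖kappa2bar c' D (m₁ * m₂)‖ /
            ((m₁ : ℝ) * m₂)
        else 0) ≤ |C₁| * (q₁.divisors.card : ℝ) * B := by
  have hNq : q₂ * (D ^ 4 / q₂) ≤ D ^ 4 := Nat.mul_div_le (D ^ 4) q₂
  -- the `m₂`-indicator is membership in the finite filtered set
  have hmem : ∀ m₂ : ℕ, ((2 ≤ m₂ ∧ Nat.Coprime m₂ q₁) ∧ (q₂ : ℝ) * m₂ ≤ (D : ℝ) ^ 4) ↔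
      m₂ ∈ (Finset.Icc 2 (D ^ 4 / q₂)).filter (fun m₂ => Nat.Coprime m₂ q₁) := by
    intro m₂
    rw [Finset.mem_filter, Finset.mem_Icc]
    constructor
    · rintro ⟨⟨h2, hc⟩, hS⟩
      have hS' : q₂ * m₂ ≤ D ^ 4 := by exact_mod_cast hS
      refine ⟨⟨h2, ?_⟩, hc⟩
      rw [Nat.le_div_iff_mul_le hq2, mul_comm]; exact hS'
    · rintro ⟨⟨h2, hN⟩, hc⟩
      refine ⟨⟨h2, hc⟩, ?_⟩
      have : q₂ * m₂ ≤ D ^ 4 := le_trans (Nat.mul_le_mul_left _ hN) hNq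
      exact_mod_cast this
  -- the inner series in `m₂` is a finite sum, with the summand factored as `(‖ν₁*‖/m₂)·(‖b‖‖κ̄₂‖/m₁)`
  have hin : ∀ m₁ : ℕ, (∑' m₂ : ℕ,
      if (2 ≤ m₂ ∧ Nat.Coprime m₂ q₁) ∧ (q₂ : ℝ) * m₂ ≤ (D : ℝ) ^ 4 then
        ‖bcoef D (q₁ * m₁)‖ * ‖nuOneStar c' χ (q₂ * m₂)‖ * ‖kappa2bar c' D (m₁ * m₂)‖ /
          ((m₁ : ℝ) * m₂)
      else 0) =
      ∑ m₂ ∈ (Finset.Icc 2 (D ^ 4 / q₂)).filter (fun m₂ => Nat.Coprime m₂ q₁),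
        ‖nuOneStar c' χ (q₂ * m₂)‖ / (m₂ : ℝ) *
          (‖bcoef D (q₁ * m₁)‖ * ‖kappa2bar c' D (m₁ * m₂)‖ / (m₁ : ℝ)) := by
    intro m₁
    rw [tsum_eq_sum (s := (Finset.Icc 2 (D ^ 4 / q₂)).filter (fun m₂ => Nat.Coprime m₂ q₁))
      (fun m₂ hm₂ => if_neg (fun h => hm₂ ((hmem m₂).1 h)))]
    refine Finset.sum_congr rfl fun m₂ hm₂ => ?_
    rw [if_pos ((hmem m₂).2 hm₂)]
    have hm₂2 : 2 ≤ m₂ := (Finset.mem_Icc.1 (Finset.mem_filter.1 hm₂).1).1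
    have hm₂0 : (m₂ : ℝ) ≠ 0 := by exact_mod_cast (show m₂ ≠ 0 by omega)
    rcases Nat.eq_zero_or_pos m₁ with h0 | h0
    · subst h0; simp
    · have hm₁0 : (m₁ : ℝ) ≠ 0 := by exact_mod_cast (show m₁ ≠ 0 by omega)
      field_simp
  -- summability in `m₁` (finite support of `b(q₁·)`), Fubini
  have hsumm : ∀ m₂ : ℕ, Summable fun m₁ : ℕ => ‖nuOneStar c' χ (q₂ * m₂)‖ / (m₂ : ℝ) *
      (‖bcoef D (q₁ * m₁)‖ * ‖kappa2bar c' D (m₁ * m₂)‖ / (m₁ : ℝ)) := by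
    intro m₂
    refine summable_of_ne_finset_zero (s := Finset.range Nb) fun m₁ hm₁ => ?_
    have : Nb ≤ m₁ := by simpa using hm₁
    rw [hbN m₁ this, norm_zero, zero_mul, zero_div, mul_zero]
  rw [tsum_congr hin, Summable.tsum_finsetSum (fun m₂ _ => hsumm m₂)]
  simp_rw [tsum_mul_left]
  -- M1 termwise (with `|C₁|`), then M2s
  have hτ0 : 0 ≤ (q₁.divisors.card : ℝ) := Nat.cast_nonneg _
  have hterm : ∀ m₂ ∈ (Finset.Icc 2 (D ^ 4 / q₂)).filter (fun m₂ => Nat.Coprime m₂ q₁),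
      ‖nuOneStar c' χ (q₂ * m₂)‖ / (m₂ : ℝ) *
          (∑' m₁ : ℕ, ‖bcoef D (q₁ * m₁)‖ * ‖kappa2bar c' D (m₁ * m₂)‖ / (m₁ : ℝ)) ≤
        |C₁| * (q₁.divisors.card : ℝ) *
          (‖nuOneStar c' χ (q₂ * m₂)‖ * ‖kappa2bar c' D m₂‖ * ((m₂ : ℝ) / Nat.totient m₂) ^ 2 /
            m₂) := by
    intro m₂ hm₂
    have hm₂2 : 2 ≤ m₂ := (Finset.mem_Icc.1 (Finset.mem_filter.1 hm₂).1).1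
    have h1 := hM1 m₂ (by omega)
    have hX0 : 0 ≤ (q₁.divisors.card : ℝ) * ‖kappa2bar c' D m₂‖ * ((m₂ : ℝ) / m₂.totient) ^ 2 := by
      positivity
    have h2 : C₁ * (q₁.divisors.card : ℝ) * ‖kappa2bar c' D m₂‖ * ((m₂ : ℝ) / m₂.totient) ^ 2 ≤
        |C₁| * (q₁.divisors.card : ℝ) * ‖kappa2bar c' D m₂‖ * ((m₂ : ℝ) / m₂.totient) ^ 2 := by
      have := mul_le_mul_of_nonneg_right (le_abs_self C₁) hX0
      calc _ = C₁ * ((q₁.divisors.card : ℝ) * ‖kappa2bar c' D m₂‖ * ((m₂ : ℝ) / m₂.totient) ^ 2) := by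
            ring
        _ ≤ |C₁| * ((q₁.divisors.card : ℝ) * ‖kappa2bar c' D m₂‖ * ((m₂ : ℝ) / m₂.totient) ^ 2) :=
            this
        _ = _ := by ring
    have h3 := mul_le_mul_of_nonneg_left (h1.trans h2)
      (show 0 ≤ ‖nuOneStar c' χ (q₂ * m₂)‖ / (m₂ : ℝ) by positivity)
    refine h3.trans (le_of_eq ?_)
    ring
  refine (Finset.sum_le_sum hterm).trans ?_
  rw [← Finset.mul_sum]
  exact mul_le_mul_of_nonneg_left hM2 (by positivity)

/-! ## §3. The small-argument piece, discharged -/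

/-- **The SMALL-ARGUMENT piece `hS` of `step17_u021Chi_R1Rel_of_split`, PROVED** (cut v3: M1
`m1Sum_le` + M2s `smallArgs_sum_eventually` + the `𝔞`-currency outer counts
`sum_nu_tau_moebiusChi_div_le_frakA` / `sum_nu_tau_tau4_div_le_frakA_cube` + `D/φ(D) ≤ 2 log 𝓛` +
`𝔞 ≤ 16e⁹𝓛⁴` + `α𝓛⁹ = π`): under (A), for all large `D`,
`Σ_{l<D⁴}|ν(l)|/l Σ_{q₁q₂=l} Σ'_{m₁}Σ'_{m₂} [2 ≤ m₂, (m₂,q₁)=1, q₂m₂ ≤ D⁴]·‖b(q₁m₁)‖‖ν₁*(q₂m₂)‖‖κ̄₂(m₁m₂)‖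
/(m₁m₂) ≤ ε(𝔞+1)` — the statement is the hypothesis `hS` VERBATIM. Each term is `≤ K(𝔞+1)/𝓛`
(`R1_small_size_one/two`; the `τ₄`-term `α²𝓛⁹(𝔞+1)³ ≪ π²(𝔞+1)/𝓛` is the tightest).
[cite: Zhang2022LandauSiegel, §17 u021 p.98] -/
theorem R1_small_holds (c' : ℝ) :
    ∀ ε : ℝ, 0 < ε → ForAllLarge fun D _ χ => AssumptionA D χ →
      (∑ l ∈ Finset.Ico 1 (D ^ 4), ‖nu χ l‖ / l *
          ∑ q ∈ l.divisorsAntidiagonal, ∑' m₁ : ℕ, ∑' m₂ : ℕ,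
            if (2 ≤ m₂ ∧ Nat.Coprime m₂ q.1) ∧ (q.2 : ℝ) * m₂ ≤ (D : ℝ) ^ 4 then
              ‖bcoef D (q.1 * m₁)‖ * ‖nuOneStar c' χ (q.2 * m₂)‖ * ‖kappa2bar c' D (m₁ * m₂)‖ /
                ((m₁ : ℝ) * m₂)
            else 0) ≤ ε * (frakA χ + 1) := by
  intro ε hε
  obtain ⟨C₁, h₁⟩ := m1Sum_le c'
  have h₂ := smallArgs_sum_eventually c'
  obtain ⟨Ca, ha⟩ := sum_nu_tau_moebiusChi_div_le_frakA
  obtain ⟨Cb, hb⟩ := sum_nu_tau_tau4_div_le_frakA_cube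
  obtain ⟨D₂, hφ⟩ := Ded1524.self_div_totient_le_two_mul_loglog
  -- the absolute constant controlling everything, and the threshold `K/𝓛 ≤ ε`
  obtain ⟨E, hE⟩ : ∃ E : ℝ, E = 16 * Real.exp 9 + 1 := ⟨_, rfl⟩
  have hE0 : 0 ≤ E := by rw [hE]; positivity
  obtain ⟨K, hK⟩ : ∃ K : ℝ, K = 25 * (|C₁| * 8 * Real.exp 32) * (|Ca| * 64) * π +
      625 * (|C₁| * 8 * (63 * Real.exp 128)) * (|Cb| * 4096) * E ^ 2 * π ^ 2 := ⟨_, rfl⟩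
  have hK0 : 0 ≤ K := by rw [hK]; positivity
  obtain ⟨D₁, hD₁⟩ := exists_nat_forall_le_ell (max 3 (K / ε))
  obtain ⟨D₀, hall⟩ := ((h₁.and h₂).and (ha.and hb))
  refine ⟨max (max D₀ D₁) D₂, fun D _ χ hD hq hp hA => ?_⟩
  have hD0 : D₀ ≤ D := le_trans (le_trans (le_max_left _ _) (le_max_left _ _)) hD
  have hD1 : D₁ ≤ D := le_trans (le_trans (le_max_right _ _) (le_max_left _ _)) hD
  have hD2 : D₂ ≤ D := le_trans (le_max_right _ _) hD
  obtain ⟨⟨e₁, e₂⟩, ea, eb⟩ := hall D χ hD0 hq hp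
  replace ea := ea hA
  replace eb := eb hA
  have hLK : max 3 (K / ε) ≤ ell D := hD₁ D hD1
  have hL3 : 3 ≤ ell D := le_trans (le_max_left _ _) hLK
  have hL1 : 1 ≤ ell D := by linarith
  have hL0 : 0 < ell D := by linarith
  have hKε : K / ε ≤ ell D := le_trans (le_max_right _ _) hLK
  have hα : alpha D = π / ell D ^ 9 := by rw [alpha, bigP, Real.log_exp]
  have hα0 : 0 < alpha D := by rw [hα]; positivity
  have hαL9 : alpha D * ell D ^ 9 = π := by rw [hα]; field_simp
  have hA0 : 0 ≤ frakA χ := frakA_nonneg χ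
  have hAE : frakA χ + 1 ≤ E * ell D ^ 4 := by
    have h1 := frakA_le_ell_pow_four' χ hL3 hp
    have h4 : (1 : ℝ) ≤ ell D ^ 4 := one_le_pow₀ hL1
    rw [hE]; nlinarith [Real.exp_pos 9]
  have hLg0 : (0 : ℝ) ≤ 1 + 4 * ell D := by positivity
  have hLg5 : 1 + 4 * ell D ≤ 5 * ell D := by linarith
  -- `D/φ(D)` against `𝓛`
  have hu0 : (0 : ℝ) ≤ (D : ℝ) / D.totient := by positivity
  obtain ⟨hu3, hu6⟩ := pow_le_of_le_two_mul_log hu0 (hφ D hD2) hL1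
  -- support of `b`
  obtain ⟨N, hbN, -⟩ := exists_R1_support χ c'
  -- per `(l, q)`
  have hinner : ∀ {l : ℕ} {q : ℕ × ℕ}, q ∈ l.divisorsAntidiagonal →
      (∑' m₁ : ℕ, ∑' m₂ : ℕ,
          if (2 ≤ m₂ ∧ Nat.Coprime m₂ q.1) ∧ (q.2 : ℝ) * m₂ ≤ (D : ℝ) ^ 4 then
            ‖bcoef D (q.1 * m₁)‖ * ‖nuOneStar c' χ (q.2 * m₂)‖ * ‖kappa2bar c' D (m₁ * m₂)‖ /
              ((m₁ : ℝ) * m₂)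
          else 0) ≤
        |C₁| * (q.1.divisors.card : ℝ) * (8 * (alpha D * ell D) *
          (Real.exp 32 * ‖∑ d ∈ q.2.divisors, (ArithmeticFunction.moebius d : ℂ) * χ (d : ZMod D)‖ *
              (1 + 4 * ell D) ^ 2 +
            63 * Real.exp 128 * (alpha D * ell D) * tau 4 q.2 * (1 + 4 * ell D) ^ 4)) := by
    intro l q hq
    have hq' := Nat.mem_divisorsAntidiagonal.1 hq
    have hq1 : 1 ≤ q.1 := Nat.pos_of_ne_zero fun h0 => hq'.2 (by rw [← hq'.1, h0, zero_mul])
    have hq2 : 1 ≤ q.2 := Nat.pos_of_ne_zero fun h0 => hq'.2 (by rw [← hq'.1, h0, mul_zero])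
    have hNq : q.2 * (D ^ 4 / q.2) ≤ D ^ 4 := Nat.mul_div_le (D ^ 4) q.2
    exact R1_small_inner χ c' hq2 (fun m hm => hbN q.1 m hq1 hm)
      (fun m₂ hm₂ => e₁ q.1 m₂ hq1 hm₂) (e₂ q.1 q.2 (D ^ 4 / q.2) hq2 hNq)
  -- sum over `l`, `q`
  have hstep : (∑ l ∈ Finset.Ico 1 (D ^ 4), ‖nu χ l‖ / l *
      ∑ q ∈ l.divisorsAntidiagonal, ∑' m₁ : ℕ, ∑' m₂ : ℕ,
        if (2 ≤ m₂ ∧ Nat.Coprime m₂ q.1) ∧ (q.2 : ℝ) * m₂ ≤ (D : ℝ) ^ 4 then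
          ‖bcoef D (q.1 * m₁)‖ * ‖nuOneStar c' χ (q.2 * m₂)‖ * ‖kappa2bar c' D (m₁ * m₂)‖ /
            ((m₁ : ℝ) * m₂)
        else 0) ≤
      ∑ l ∈ Finset.Ico 1 (D ^ 4), ‖nu χ l‖ / l *
        ∑ q ∈ l.divisorsAntidiagonal, |C₁| * (q.1.divisors.card : ℝ) * (8 * (alpha D * ell D) *
          (Real.exp 32 * ‖∑ d ∈ q.2.divisors, (ArithmeticFunction.moebius d : ℂ) * χ (d : ZMod D)‖ *
              (1 + 4 * ell D) ^ 2 +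
            63 * Real.exp 128 * (alpha D * ell D) * tau 4 q.2 * (1 + 4 * ell D) ^ 4)) := by
    refine Finset.sum_le_sum fun l _ => mul_le_mul_of_nonneg_left ?_ (by positivity)
    exact Finset.sum_le_sum fun q hq => hinner hq
  have halg : (∑ l ∈ Finset.Ico 1 (D ^ 4), ‖nu χ l‖ / l *
        ∑ q ∈ l.divisorsAntidiagonal, |C₁| * (q.1.divisors.card : ℝ) * (8 * (alpha D * ell D) *
          (Real.exp 32 * ‖∑ d ∈ q.2.divisors, (ArithmeticFunction.moebius d : ℂ) * χ (d : ZMod D)‖ *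
              (1 + 4 * ell D) ^ 2 +
            63 * Real.exp 128 * (alpha D * ell D) * tau 4 q.2 * (1 + 4 * ell D) ^ 4))) =
      (|C₁| * 8 * Real.exp 32) * (alpha D * ell D) * (1 + 4 * ell D) ^ 2 *
          (∑ l ∈ Finset.Ico 1 (D ^ 4), ‖nu χ l‖ / l *
            ∑ q ∈ l.divisorsAntidiagonal, (q.1.divisors.card : ℝ) *
              ‖∑ d ∈ q.2.divisors, (ArithmeticFunction.moebius d : ℂ) * χ (d : ZMod D)‖) +
        (|C₁| * 8 * (63 * Real.exp 128)) * (alpha D * ell D) * (alpha D * ell D) *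
            (1 + 4 * ell D) ^ 4 *
          (∑ l ∈ Finset.Ico 1 (D ^ 4), ‖nu χ l‖ / l *
            ∑ q ∈ l.divisorsAntidiagonal, (q.1.divisors.card : ℝ) * tau 4 q.2) := by
    simp only [Finset.mul_sum, ← Finset.sum_add_distrib]
    refine Finset.sum_congr rfl fun l _ => Finset.sum_congr rfl fun q _ => ?_
    ring
  refine hstep.trans ?_
  rw [halg]
  -- the two outer counts, with `D/φ(D)`-powers against `𝓛`
  have hS₁0 : 0 ≤ ∑ l ∈ Finset.Ico 1 (D ^ 4), ‖nu χ l‖ / l *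
      ∑ q ∈ l.divisorsAntidiagonal, (q.1.divisors.card : ℝ) *
        ‖∑ d ∈ q.2.divisors, (ArithmeticFunction.moebius d : ℂ) * χ (d : ZMod D)‖ :=
    Finset.sum_nonneg fun l _ => mul_nonneg (by positivity)
      (Finset.sum_nonneg fun q _ => mul_nonneg (Nat.cast_nonneg _) (norm_nonneg _))
  have hS₂0 : 0 ≤ ∑ l ∈ Finset.Ico 1 (D ^ 4), ‖nu χ l‖ / l *
      ∑ q ∈ l.divisorsAntidiagonal, (q.1.divisors.card : ℝ) * tau 4 q.2 :=
    Finset.sum_nonneg fun l _ => mul_nonneg (by positivity)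
      (Finset.sum_nonneg fun q _ => mul_nonneg (Nat.cast_nonneg _) (tau_nonneg _ _))
  have hS₁le : (∑ l ∈ Finset.Ico 1 (D ^ 4), ‖nu χ l‖ / l *
      ∑ q ∈ l.divisorsAntidiagonal, (q.1.divisors.card : ℝ) *
        ‖∑ d ∈ q.2.divisors, (ArithmeticFunction.moebius d : ℂ) * χ (d : ZMod D)‖) ≤
      (|Ca| * 64) * (frakA χ + 1) * ell D ^ 2 := by
    refine ea.trans ?_
    have h0 : 0 ≤ (frakA χ + 1) * ((D : ℝ) / D.totient) ^ 3 := by positivity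
    have h1 := mul_le_mul_of_nonneg_right (le_abs_self Ca) h0
    have h2 := mul_le_mul_of_nonneg_left hu3 (show 0 ≤ |Ca| * (frakA χ + 1) by positivity)
    calc Ca * (frakA χ + 1) * ((D : ℝ) / D.totient) ^ 3
        = Ca * ((frakA χ + 1) * ((D : ℝ) / D.totient) ^ 3) := by ring
      _ ≤ |Ca| * ((frakA χ + 1) * ((D : ℝ) / D.totient) ^ 3) := h1
      _ = |Ca| * (frakA χ + 1) * ((D : ℝ) / D.totient) ^ 3 := by ring
      _ ≤ |Ca| * (frakA χ + 1) * (64 * ell D ^ 2) := h2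
      _ = (|Ca| * 64) * (frakA χ + 1) * ell D ^ 2 := by ring
  have hS₂le : (∑ l ∈ Finset.Ico 1 (D ^ 4), ‖nu χ l‖ / l *
      ∑ q ∈ l.divisorsAntidiagonal, (q.1.divisors.card : ℝ) * tau 4 q.2) ≤
      (|Cb| * 4096) * (frakA χ + 1) ^ 3 * ell D ^ 3 := by
    refine eb.trans ?_
    have h0 : 0 ≤ (frakA χ + 1) ^ 3 * ((D : ℝ) / D.totient) ^ 6 := by positivity
    have h1 := mul_le_mul_of_nonneg_right (le_abs_self Cb) h0
    have h2 := mul_le_mul_of_nonneg_left hu6 (show 0 ≤ |Cb| * (frakA χ + 1) ^ 3 by positivity)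
    calc Cb * (frakA χ + 1) ^ 3 * ((D : ℝ) / D.totient) ^ 6
        = Cb * ((frakA χ + 1) ^ 3 * ((D : ℝ) / D.totient) ^ 6) := by ring
      _ ≤ |Cb| * ((frakA χ + 1) ^ 3 * ((D : ℝ) / D.totient) ^ 6) := h1
      _ = |Cb| * (frakA χ + 1) ^ 3 * ((D : ℝ) / D.totient) ^ 6 := by ring
      _ ≤ |Cb| * (frakA χ + 1) ^ 3 * (4096 * ell D ^ 3) := h2
      _ = (|Cb| * 4096) * (frakA χ + 1) ^ 3 * ell D ^ 3 := by ring
  have key1 := R1_small_size_one (c := |C₁| * 8 * Real.exp 32) hL1 hαL9 hα0.le (by positivity)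
    hLg0 hLg5 hA0 (by positivity) hS₁0 hS₁le
  have key2 := R1_small_size_two (c := |C₁| * 8 * (63 * Real.exp 128)) hL1 hαL9 hα0.le
    (by positivity) hLg0 hLg5 hA0 hAE (by positivity) hS₂0 hS₂le
  refine (add_le_add key1 key2).trans ?_
  rw [← add_div, div_le_iff₀ hL0]
  have h1 : K ≤ ε * ell D := by
    have := (div_le_iff₀ hε).mp hKε
    linarith
  have hA1 : 0 ≤ frakA χ + 1 := by linarith
  have eK : 25 * (|C₁| * 8 * Real.exp 32) * (|Ca| * 64) * π * (frakA χ + 1) +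
      625 * (|C₁| * 8 * (63 * Real.exp 128)) * (|Cb| * 4096) * E ^ 2 * π ^ 2 * (frakA χ + 1) =
      K * (frakA χ + 1) := by rw [hK]; ring
  rw [eK]
  calc K * (frakA χ + 1) ≤ ε * ell D * (frakA χ + 1) := mul_le_mul_of_nonneg_right h1 hA1
    _ = ε * (frakA χ + 1) * ell D := by ring

end Literature.NumberTheory.LFunctions.Zhang2022.Phi3Eval
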